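import Summits.MatrixMultiplication.OmegaCensus.SmallFormats.InvertiblePointDeltaLaw
import Summits.MatrixMultiplication.OmegaCensus.SmallFormats.InvertiblePointTwoColumnClause
import Summits.MatrixMultiplication.OmegaCensus.SmallFormats.InvertiblePointKernelSplit
import HarnessLib

/-!
# ω-census family (a): the δ-LAW, second form — a saturated invertible point forces `3r ≥ 10n + 2` (`n ≥ 4`)

Cell `pub-omega` (unit `pub-omega-tensor`, gen 34), topic `Summits/MatrixMultiplication/OmegaCensus` (sub-folder
`SmallFormats`). Framing (verbatim): lottery ticket; floor = certified bounds/negative ranges. HONEST FRAMING: the structural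
theorem of `InvertiblePointDeltaLaw` (`10n + 1 ≤ 3r`, any field) with ONE improvement: two free columns (`L₁ᵀ` blocks) cost TWO
dimensions of the common kernel `K₀` (two-column clause, `InvertiblePointTwoColumnClause` = the abstract form of tensor g27's
`LC+1` law). Result (`ten_mul_add_two_le_or_of_saturated_one`): at a saturated `X₀ = 1` of an `r`-term computation of `⟨2,2,n⟩`
over any field, `10n + 2 ≤ 3r` or `7n ≤ 2r`. Both alternatives are attained by real schemes with saturated invertible points
(`⟨2,2,4⟩@14`: `42 = 42`; Strassen's `⟨2,2,2⟩@7`: `14 = 14`). Steps 0–7 repeat the first form (Kronecker decomposition of the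
vanishing outputs' span, δ-table, no `L_ε` blocks, free-column clause); step 7b is new. Census consequences (no saturated point at
`⟨2,2,5⟩@17` — the 60 481 IP-orbits of the `𝔽₃` census — and at `⟨2,2,8⟩@27`) are in `InvertiblePointDeltaLawCensus2`. Nothing
here is a bound on `ω`.
-/

namespace Summit.MatrixMultiplication.OmegaCensus.SmallFormats

open Module Submodule Matrix Kronecker Kronecker.KBlock DeltaBlocks Literature.Computability.AlgebraicComplexity

namespace DeltaLaw

variable {k : Type*} [Field k] {n : ℕ} {ι : Type*} [Fintype ι] [DecidableEq ι]

/-! ## The δ-law with the two-column clause -/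

/-- **The δ-LAW, second form.** If a bilinear computation of `⟨2,2,n⟩` (`n ≥ 1`) with `r` terms attains the invertible-point
cap at `X₀ = 1` (exactly `2n` terms do not vanish at `1`), then `10n + 2 ≤ 3r` or `7n ≤ 2r`; in particular `10n + 2 ≤ 3r`
when `n ≥ 4` (`ten_mul_add_two_le_of_saturated_one`). -/
theorem ten_mul_add_two_le_or_of_saturated_one (β : BilinComp (mulBilin k 2 2 n) ι) (O : Finset ι)
    (hO : ∀ i, i ∉ O → β.f i 1 = 0) (hO' : ∀ i ∈ O, β.f i 1 ≠ 0) (hcard : O.card = 2 * n) :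
    10 * n + 2 ≤ 3 * Fintype.card ι ∨ 7 * n ≤ 2 * Fintype.card ι := by
  classical
  set Zs : Finset ι := Finset.univ \ O with hZs
  have hZcard : Zs.card = Fintype.card ι - O.card := by
    rw [hZs, Finset.card_sdiff, Finset.inter_univ, Finset.card_univ]
  have hOle : O.card ≤ Fintype.card ι := Finset.card_le_univ O
  set 𝒲 : Submodule k (Matrix (Fin 2) (Fin n) k) := Submodule.span k (Set.range fun t : Zs => β.w (t : ι)) with h𝒲
  have h𝒲dim : finrank k 𝒲 ≤ Fintype.card ι - O.card := by
    rw [← hZcard, ← Fintype.card_coe Zs]; exact finrank_range_le_card _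
  have hwmem : ∀ t, t ∉ O → β.w t ∈ 𝒲 := fun t ht =>
    Submodule.subset_span ⟨⟨t, Finset.mem_sdiff.mpr ⟨Finset.mem_univ t, ht⟩⟩, rfl⟩
  let a : 𝒲 →ₗ[k] (Fin n → k) := (rowLM n 0).comp 𝒲.subtype
  let b : 𝒲 →ₗ[k] (Fin n → k) := (rowLM n 1).comp 𝒲.subtype
  have hab : ∀ u : 𝒲, ∀ s : Fin 2, (u : Matrix (Fin 2) (Fin n) k) s = if s = 0 then a u else b u := by
    intro u s; fin_cases s <;> rfl
  obtain ⟨N, blk, e, f, D, -⟩ := kronecker_blockDecomposition a b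
  let J := Σ i : Fin N, Fin (blk i).cols
  let F : J → (Fin n → k) := fun p => f p.1 p.2
  have hFspan : ⊤ ≤ Submodule.span k (Set.range F) := by
    rintro v -
    obtain ⟨g, hg⟩ := D.span_f v
    rw [hg]
    exact Submodule.sum_mem _ fun i _ => Submodule.sum_mem _ fun c hc =>
      Submodule.smul_mem _ _ (Submodule.subset_span ⟨⟨i, ⟨c, Finset.mem_range.mp hc⟩⟩, rfl⟩)
  have hnfin : finrank k (Fin n → k) = n := Module.finrank_fin_fun k
  have hFcard : Fintype.card J = finrank k (Fin n → k) := by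
    rw [Fintype.card_sigma, ← D.cols_eq]; simp
  let bF := basisOfTopLeSpanOfCardEqFinrank F hFspan hFcard
  have hbF : ∀ p, bF p = F p := fun p => by
    simp [bF, coe_basisOfTopLeSpanOfCardEqFinrank]
  have hcoordf : ∀ (p : J) (i : Fin N) (c : ℕ) (hc : c < (blk i).cols),
      bF.coord p (f i c) = if (⟨i, ⟨c, hc⟩⟩ : J) = p then 1 else 0 := by
    intro p i c hc
    have : f i c = bF ⟨i, ⟨c, hc⟩⟩ := by rw [hbF]
    rw [this, Basis.coord_apply, Basis.repr_self, Finsupp.single_apply]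
  let M : ∀ i : Fin N, Matrix (Fin n) (Fin (blk i).cols) k := fun i j c => bF.coord ⟨i, c⟩ (Pi.single j 1)
  have hMapply : ∀ i (W : Matrix (Fin 2) (Fin n) k) (s : Fin 2) (c : Fin (blk i).cols),
      (W * M i) s c = bF.coord ⟨i, c⟩ (W s) := by
    intro i W s c
    rw [Matrix.mul_apply]
    conv_rhs => rw [eq_sum_smul_single (W s), map_sum]
    refine Finset.sum_congr rfl fun j _ => ?_
    rw [map_smul, smul_eq_mul]
  have hM : ∀ W : Matrix (Fin 2) (Fin n) k, (∀ i, W * M i = 0) → W = 0 := by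
    intro W hW
    ext s j
    have hz : W s = 0 := by
      refine (bF.forall_coord_eq_zero_iff).mp fun p => ?_
      obtain ⟨i, c⟩ := p
      rw [← hMapply i W s c, hW i, Matrix.zero_apply]
    rw [hz]; rfl
  have heM : ∀ (i b' : Fin N) (r : ℕ) (hr : r < (blk i).rows),
      ((e i r : Matrix (Fin 2) (Fin n) k) * M b') = if h : i = b' then h ▸ (blk i).gen r else 0 := by
    intro i b' r hr
    ext s c
    rw [hMapply, hab]
    have hA := D.rel_a i r hr
    have hB := D.rel_b i r hr
    by_cases hib : i = b'
    · subst hib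
      rw [dif_pos rfl]
      have key : ∀ G : ℕ → ℕ → k,
          bF.coord ⟨i, c⟩ (∑ c' ∈ Finset.range (blk i).cols, G r c' • f i c') = G r c := by
        intro G
        rw [map_sum, Finset.sum_eq_single_of_mem (c : ℕ) (Finset.mem_range.mpr c.2)]
        · rw [map_smul, hcoordf _ i c c.2, if_pos rfl, smul_eq_mul, mul_one]
        · intro c' hc' hne
          rw [map_smul, hcoordf _ i c' (Finset.mem_range.mp hc'), if_neg, smul_zero]
          intro h; apply hne
          have := congrArg (fun q : J => (q.2 : ℕ)) h
          simpa using this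
      fin_cases s
      · simp only [Fin.zero_eta, Fin.isValue, ↓reduceIte]; rw [hA, gen_zero_apply]; exact key _
      · simp only [Fin.mk_one, Fin.isValue, one_ne_zero, ↓reduceIte]; rw [hB, gen_one_apply]; exact key _
    · rw [dif_neg hib, Matrix.zero_apply]
      have key : ∀ (G : ℕ → ℕ → k), bF.coord ⟨b', c⟩ (∑ c' ∈ Finset.range (blk i).cols, G r c' • f i c') = 0 := by
        intro G
        rw [map_sum]
        refine Finset.sum_eq_zero fun c' hc' => ?_
        rw [map_smul, hcoordf _ i c' (Finset.mem_range.mp hc'), if_neg, smul_zero]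
        intro h
        exact hib (congrArg Sigma.fst h)
      fin_cases s
      · simp only [Fin.zero_eta, Fin.isValue, ↓reduceIte]; rw [hA]; exact key _
      · simp only [Fin.mk_one, Fin.isValue, one_ne_zero, ↓reduceIte]; rw [hB]; exact key _
  have hWM : ∀ (u : 𝒲) (b' : Fin N), (u : Matrix (Fin 2) (Fin n) k) * M b' ∈ (blk b').space := by
    intro u b'
    obtain ⟨g, hg⟩ := D.span_e u
    have hu : (u : Matrix (Fin 2) (Fin n) k) =
        ∑ i, ∑ r ∈ Finset.range (blk i).rows, g i r • (e i r : Matrix (Fin 2) (Fin n) k) := by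
      conv_lhs => rw [hg]
      rw [Submodule.coe_sum]
      refine Finset.sum_congr rfl fun i _ => ?_
      rw [Submodule.coe_sum]
      refine Finset.sum_congr rfl fun r _ => ?_
      rw [Submodule.coe_smul]
    rw [hu, Matrix.sum_mul]
    refine Submodule.sum_mem _ fun i _ => ?_
    rw [Matrix.sum_mul]
    refine Submodule.sum_mem _ fun r hr => ?_
    rw [Matrix.smul_mul]
    refine Submodule.smul_mem _ _ ?_
    rw [heM i b' r (Finset.mem_range.mp hr)]
    by_cases hib : i = b'
    · subst hib
      rw [dif_pos rfl]
      exact Submodule.subset_span ⟨⟨r, Finset.mem_range.mp hr⟩, rfl⟩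
    · rw [dif_neg hib]; exact Submodule.zero_mem _
  have hS : ∀ (b' : Fin N) (t : ι), t ∉ O → β.w t * M b' ∈ (blk b').space := fun b' t ht =>
    hWM ⟨β.w t, hwmem t ht⟩ b'
  have hsurj : ∀ (b' : Fin N) (B' : Matrix (Fin 2) (Fin (blk b').cols) k),
      ∃ W : Matrix (Fin 2) (Fin n) k, W * M b' = B' := by
    intro b' B'
    refine ⟨fun s => ∑ c, B' s c • f b' c, ?_⟩
    ext s c
    rw [hMapply, map_sum]
    simp_rw [map_smul]
    rw [Finset.sum_eq_single c]
    · rw [hcoordf _ b' c c.2, if_pos rfl, smul_eq_mul, mul_one]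
    · intro c' _ hne
      rw [hcoordf _ b' c' c'.2, if_neg, smul_zero]
      intro h; apply hne
      have := congrArg (fun q : J => (q.2 : ℕ)) h
      exact Fin.ext (by simpa using this)
    · intro h; exact absurd (Finset.mem_univ c) h
  have noL : ∀ (b' : Fin N) (e' : ℕ), blk b' ≠ KBlock.L e' := by
    intro b'
    refine ne_L_of_footprints (blk b') (Set.range fun s : O => β.w (s : ι) * M b') ?_ ?_
    · -- spanning
      rintro B' -
      obtain ⟨W, hW⟩ := hsurj b' B'
      have hWspan : W ∈ Submodule.span k (Set.range fun i : O => β.w (i : ι)) :=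
        top_le_span_w_off β 1 isUnit_det_one_fin_two O hO Submodule.mem_top
      rw [← hW]
      refine Submodule.span_induction (p := fun W _ => W * M b' ∈ Submodule.span k
          (Set.range fun s : O => β.w (s : ι) * M b')) ?_ ?_ ?_ ?_ hWspan
      · rintro _ ⟨s, rfl⟩; exact Submodule.subset_span ⟨s, rfl⟩
      · rw [Matrix.zero_mul]; exact Submodule.zero_mem _
      · intro x y _ _ hx hy; rw [Matrix.add_mul]; exact Submodule.add_mem _ hx hy
      · intro c x _ hx; rw [Matrix.smul_mul]; exact Submodule.smul_mem _ _ hx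
    · rintro _ ⟨s, rfl⟩
      exact ⟨β.f s, hO' s s.2, fun X => block_footprint_mem β O hO hO' hcard (M b') _ (hS b') s.2 X⟩
  set K₀ := LinearMap.ker (LinearMap.pi fun t : ↥(Finset.univ \ O) => β.g (t : ι)) with hK₀
  have memK₀ : ∀ W, W ∈ K₀ ↔ ∀ t, t ∉ O → β.g t W = 0 := fun W => by
    rw [hK₀, LinearMap.mem_ker]
    constructor
    · intro h t ht
      have := congr_fun h ⟨t, Finset.mem_sdiff.mpr ⟨Finset.mem_univ t, ht⟩⟩
      simpa using this
    · intro h; funext t; simpa using h t (Finset.mem_sdiff.mp t.2).2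
  have hdimK : 2 * n ≤ finrank k K₀ + (Fintype.card ι - O.card) := by
    have h1 := LinearMap.finrank_range_add_finrank_ker (LinearMap.pi fun t : ↥(Finset.univ \ O) => β.g (t : ι))
    rw [finrank_matrix_fin, ← hK₀] at h1
    have h2 : finrank k (LinearMap.range (LinearMap.pi fun t : ↥(Finset.univ \ O) => β.g (t : ι))) ≤
        Fintype.card ι - O.card := by
      calc finrank k (LinearMap.range (LinearMap.pi fun t : ↥(Finset.univ \ O) => β.g (t : ι)))
          ≤ finrank k (↥(Finset.univ \ O) → k) := Submodule.finrank_le _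
        _ = Fintype.card ι - O.card := by
            rw [finrank_fintype_fun_eq_card, Fintype.card_coe, ← hZs, hZcard]
    omega
  let π : ∀ i : Fin N, Matrix (Fin 2) (Fin n) k →ₗ[k] Matrix (Fin 2) (Fin (blk i).cols) k :=
    fun i => (mulBilin k 2 n (blk i).cols).flip (M i)
  have hπ : ∀ i W, π i W = W * M i := fun i W => by simp [π, LinearMap.flip_apply, mulBilin_apply]
  have hδ : ∀ i, finrank k (K₀.map (π i)) ≤ (blk i).delta := fun i =>
    (finrank_block_map_ker_le β O hO hO' hcard (M i) _ (hS i)).trans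
      (finrank_inf_le_delta (blk i) (span_off_le_deltaSpan β.f O hO' _))
  have hKsum : finrank k K₀ ≤ ∑ i, (blk i).delta :=
    (finrank_le_sum_finrank_map K₀ π fun W _ hW => hM W fun i => by rw [← hπ]; exact hW i).trans
      (Finset.sum_le_sum fun i _ => hδ i)
  have hstrict : ∀ b₀, blk b₀ = KBlock.LT 1 → finrank k K₀ + 1 ≤ ∑ i, (blk i).delta := by
    intro b₀ hb₀
    have hc0 : 0 < (blk b₀).cols := by rw [hb₀]; exact Nat.one_pos
    have hcc : (blk b₀).cols = 1 := by rw [hb₀]; rfl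
    set ρ : Fin n → k := f b₀ 0 with hρ
    have hρne : ρ ≠ 0 := by
      have : ρ = bF ⟨b₀, ⟨0, hc0⟩⟩ := by rw [hbF]
      rw [this]; exact bF.ne_zero _
    let vz : (Fin 2 → k) →ₗ[k] Matrix (Fin 2) (Fin n) k :=
      { toFun := fun z => vecMulVec z ρ
        map_add' := fun z z' => by ext i j; simp [vecMulVec_apply, add_mul]
        map_smul' := fun c z => by ext i j; simp [vecMulVec_apply, mul_assoc] }
    set E := LinearMap.range vz with hE
    have hEdim : finrank k E ≤ 2 := by
      calc finrank k E ≤ finrank k (Fin 2 → k) := LinearMap.finrank_range_le vz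
        _ = 2 := Module.finrank_fin_fun k
    have hKE : finrank k ↥(K₀ ⊓ E) ≤ 1 := by
      by_contra hlt
      have h2 : finrank k E ≤ finrank k ↥(K₀ ⊓ E) := by omega
      have hEq : K₀ ⊓ E = E := Submodule.eq_of_le_of_finrank_le inf_le_right h2
      have hEK : E ≤ K₀ := hEq ▸ inf_le_left
      refine not_forall_vecMulVec_mem_ker β O hO hO' hcard hρne fun z t ht => ?_
      exact (memK₀ _).mp (hEK ⟨z, rfl⟩) t ht
    have hEker : ∀ W ∈ K₀, (∀ i, i ≠ b₀ → π i W = 0) → W ∈ E := by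
      intro W hW hWi
      have hWi' : ∀ i, i ≠ b₀ → W * M i = 0 := fun i hi => by rw [← hπ]; exact hWi i hi
      refine ⟨fun s => bF.coord ⟨b₀, ⟨0, hc0⟩⟩ (W s), ?_⟩
      change vecMulVec _ ρ = _
      ext s j
      rw [vecMulVec_apply]
      have hexp := (bF.sum_repr (W s)).symm
      have hrow : W s = bF.coord ⟨b₀, ⟨0, hc0⟩⟩ (W s) • ρ := by
        conv_lhs => rw [hexp]
        rw [Finset.sum_eq_single (⟨b₀, ⟨0, hc0⟩⟩ : J)]
        · rw [hbF]; rfl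
        · rintro ⟨i, c⟩ - hne
          by_cases hi : i = b₀
          · subst hi
            exfalso; apply hne
            have hc : c = ⟨0, hc0⟩ := by
              apply Fin.ext; have h1 : (c : ℕ) < 1 := lt_of_lt_of_eq c.2 hcc; change (c : ℕ) = 0; omega
            rw [hc]
          · have : bF.repr (W s) ⟨i, c⟩ = 0 := by
              rw [← Basis.coord_apply, ← hMapply i _ s c, hWi' i hi, Matrix.zero_apply]
            rw [this, zero_smul]
        · intro h; exact absurd (Finset.mem_univ _) h
      have := congr_fun hrow j
      rw [Pi.smul_apply, smul_eq_mul] at this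
      exact this.symm
    have hsplitK := finrank_le_inf_add_sum K₀ π (fun i => i ≠ b₀) E hEker
    have hrange : ∑ i : {i : Fin N // i ≠ b₀}, finrank k ↥(K₀.map (π (i : Fin N))) ≤
        ∑ i : {i : Fin N // i ≠ b₀}, (blk i).delta := Finset.sum_le_sum fun i _ => hδ i
    have hsplit : ∑ i, (blk i).delta = (blk b₀).delta + ∑ i : {i : Fin N // i ≠ b₀}, (blk i).delta := by
      rw [Fintype.sum_eq_add_sum_compl b₀]
      congr 1
      exact Finset.sum_subtype _ (fun i => by simp [Finset.mem_compl]) (fun i => (blk i).delta)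
    have hd0 : (blk b₀).delta = 2 := by rw [hb₀]; rfl
    omega
  have hstrict2 : ∀ b₁ b₂, b₁ ≠ b₂ → blk b₁ = KBlock.LT 1 → blk b₂ = KBlock.LT 1 →
      finrank k K₀ + 2 ≤ ∑ i, (blk i).delta := by
    intro b₁ b₂ hne hb₁ hb₂
    have hc1 : 0 < (blk b₁).cols := by rw [hb₁]; exact Nat.one_pos
    have hc2 : 0 < (blk b₂).cols := by rw [hb₂]; exact Nat.one_pos
    have hcc1 : (blk b₁).cols = 1 := by rw [hb₁]; rfl
    have hcc2 : (blk b₂).cols = 1 := by rw [hb₂]; rfl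
    set ρ₁ : Fin n → k := f b₁ 0 with hρ₁
    set ρ₂ : Fin n → k := f b₂ 0 with hρ₂
    have hρ₁F : ρ₁ = bF ⟨b₁, ⟨0, hc1⟩⟩ := by rw [hbF]
    have hρ₂F : ρ₂ = bF ⟨b₂, ⟨0, hc2⟩⟩ := by rw [hbF]
    have hp12 : (⟨b₁, ⟨0, hc1⟩⟩ : J) ≠ ⟨b₂, ⟨0, hc2⟩⟩ := fun h => hne (congrArg Sigma.fst h)
    have hc11 : bF.coord ⟨b₁, ⟨0, hc1⟩⟩ ρ₁ = 1 := by
      rw [hρ₁F, Basis.coord_apply, Basis.repr_self, Finsupp.single_apply, if_pos rfl]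
    have hc12 : bF.coord ⟨b₁, ⟨0, hc1⟩⟩ ρ₂ = 0 := by
      rw [hρ₂F, Basis.coord_apply, Basis.repr_self, Finsupp.single_apply, if_neg hp12.symm]
    have hc21 : bF.coord ⟨b₂, ⟨0, hc2⟩⟩ ρ₁ = 0 := by
      rw [hρ₁F, Basis.coord_apply, Basis.repr_self, Finsupp.single_apply, if_neg hp12]
    have hc22 : bF.coord ⟨b₂, ⟨0, hc2⟩⟩ ρ₂ = 1 := by
      rw [hρ₂F, Basis.coord_apply, Basis.repr_self, Finsupp.single_apply, if_pos rfl]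
    have hind : ∀ a c : k, a • ρ₁ + c • ρ₂ = 0 → a = 0 ∧ c = 0 := by
      intro a c h
      have h1 := congrArg (fun v => bF.coord ⟨b₁, ⟨0, hc1⟩⟩ v) h
      have h2 := congrArg (fun v => bF.coord ⟨b₂, ⟨0, hc2⟩⟩ v) h
      simp only [map_add, map_smul, map_zero, smul_eq_mul, hc11, hc12, hc21, hc22, mul_one, mul_zero,
        add_zero, zero_add] at h1 h2
      exact ⟨h1, h2⟩
    let gE : Fin 2 × Fin 2 → Matrix (Fin 2) (Fin n) k :=
      fun p => vecMulVec (Pi.single p.1 (1 : k)) (if p.2 = 0 then ρ₁ else ρ₂)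
    set E := Submodule.span k (Set.range gE) with hE
    have hEdim : finrank k E ≤ 4 := by
      calc finrank k E ≤ Fintype.card (Fin 2 × Fin 2) := finrank_range_le_card gE
        _ = 4 := by simp
    have hEmem : ∀ (x : Fin 2 → k) (a c : k), vecMulVec x (a • ρ₁ + c • ρ₂) ∈ E := by
      intro x a c
      rw [vecMulVec_add, vecMulVec_smul, vecMulVec_smul, eq_single_add_single x, add_vecMulVec, add_vecMulVec,
        smul_vecMulVec, smul_vecMulVec, smul_vecMulVec, smul_vecMulVec]
      have g00 : vecMulVec (Pi.single 0 (1 : k)) ρ₁ ∈ E := Submodule.subset_span ⟨(0, 0), rfl⟩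
      have g10 : vecMulVec (Pi.single 1 (1 : k)) ρ₁ ∈ E := Submodule.subset_span ⟨(1, 0), rfl⟩
      have g01 : vecMulVec (Pi.single 0 (1 : k)) ρ₂ ∈ E := Submodule.subset_span ⟨(0, 1), rfl⟩
      have g11 : vecMulVec (Pi.single 1 (1 : k)) ρ₂ ∈ E := Submodule.subset_span ⟨(1, 1), rfl⟩
      exact add_mem (E.smul_mem _ (add_mem (E.smul_mem _ g00) (E.smul_mem _ g10)))
        (E.smul_mem _ (add_mem (E.smul_mem _ g01) (E.smul_mem _ g11)))
    have hKE : finrank k ↥(K₀ ⊓ E) ≤ 2 := by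
      by_contra hlt
      exact two_column_clause β O hO hO' hcard hind K₀ (fun W hW => (memK₀ W).mp hW) E hEmem (by omega)
    have hEker : ∀ W ∈ K₀, (∀ i, (i ≠ b₁ ∧ i ≠ b₂) → π i W = 0) → W ∈ E := by
      intro W hW hWi
      have hWi' : ∀ i, i ≠ b₁ → i ≠ b₂ → W * M i = 0 := fun i h1 h2 => by rw [← hπ]; exact hWi i ⟨h1, h2⟩
      have hrow : ∀ s, W s = bF.coord ⟨b₁, ⟨0, hc1⟩⟩ (W s) • ρ₁ + bF.coord ⟨b₂, ⟨0, hc2⟩⟩ (W s) • ρ₂ := by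
        intro s
        have hexp := (bF.sum_repr (W s)).symm
        conv_lhs => rw [hexp]
        rw [← Finset.sum_subset (Finset.subset_univ ({⟨b₁, ⟨0, hc1⟩⟩, ⟨b₂, ⟨0, hc2⟩⟩} : Finset J))]
        · rw [Finset.sum_pair hp12, hρ₁F, hρ₂F]; rfl
        · rintro ⟨i, c⟩ - hni
          rw [Finset.mem_insert, Finset.mem_singleton, not_or] at hni
          by_cases hi1 : i = b₁
          · subst hi1
            exfalso; apply hni.1
            have hc : c = ⟨0, hc1⟩ := by
              apply Fin.ext; have h1 : (c : ℕ) < 1 := lt_of_lt_of_eq c.2 hcc1; change (c : ℕ) = 0; omega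
            rw [hc]
          by_cases hi2 : i = b₂
          · subst hi2
            exfalso; apply hni.2
            have hc : c = ⟨0, hc2⟩ := by
              apply Fin.ext; have h1 : (c : ℕ) < 1 := lt_of_lt_of_eq c.2 hcc2; change (c : ℕ) = 0; omega
            rw [hc]
          · have : bF.repr (W s) ⟨i, c⟩ = 0 := by
              rw [← Basis.coord_apply, ← hMapply i _ s c, hWi' i hi1 hi2, Matrix.zero_apply]
            rw [this, zero_smul]
      have hWeq : W = vecMulVec (fun s => bF.coord ⟨b₁, ⟨0, hc1⟩⟩ (W s)) ρ₁ +
          vecMulVec (fun s => bF.coord ⟨b₂, ⟨0, hc2⟩⟩ (W s)) ρ₂ := by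
        ext s j
        rw [Matrix.add_apply, vecMulVec_apply, vecMulVec_apply]
        have := congr_fun (hrow s) j
        rw [Pi.add_apply, Pi.smul_apply, Pi.smul_apply, smul_eq_mul, smul_eq_mul] at this
        exact this
      rw [hWeq]
      have h1 := hEmem (fun s => bF.coord ⟨b₁, ⟨0, hc1⟩⟩ (W s)) 1 0
      have h2 := hEmem (fun s => bF.coord ⟨b₂, ⟨0, hc2⟩⟩ (W s)) 0 1
      rw [one_smul, zero_smul, add_zero] at h1; rw [zero_smul, one_smul, zero_add] at h2
      exact add_mem h1 h2
    have hsplitK := finrank_le_inf_add_sum K₀ π (fun i => i ≠ b₁ ∧ i ≠ b₂) E hEker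
    have hrange : ∑ i : {i : Fin N // i ≠ b₁ ∧ i ≠ b₂}, finrank k ↥(K₀.map (π (i : Fin N))) ≤
        ∑ i : {i : Fin N // i ≠ b₁ ∧ i ≠ b₂}, (blk i).delta := Finset.sum_le_sum fun i _ => hδ i
    have hsplit : ∑ i, (blk i).delta =
        (blk b₁).delta + ((blk b₂).delta + ∑ i : {i : Fin N // i ≠ b₁ ∧ i ≠ b₂}, (blk i).delta) := by
      rw [Fintype.sum_eq_add_sum_compl b₁]
      congr 1
      have hb₂mem : b₂ ∈ ({b₁}ᶜ : Finset (Fin N)) := by simp [Finset.mem_compl, hne.symm]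
      rw [← Finset.add_sum_erase _ _ hb₂mem]
      congr 1
      exact Finset.sum_subtype _ (fun i => by
        simp only [Finset.mem_erase, Finset.mem_compl, Finset.mem_singleton]; tauto) (fun i => (blk i).delta)
    have hd1 : (blk b₁).delta = 2 := by rw [hb₁]; rfl
    have hd2 : (blk b₂).delta = 2 := by rw [hb₂]; rfl
    omega
  have hrows : ∑ i, (blk i).rows = finrank k 𝒲 := D.rows_eq
  have hcols : ∑ i, (blk i).cols = n := by rw [D.cols_eq, hnfin]
  have hsum2 : ∑ i, (blk i).delta + 2 * ∑ i, (blk i).cols ≤ 2 * ∑ i, (blk i).rows := by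
    rw [Finset.mul_sum, Finset.mul_sum, ← Finset.sum_add_distrib]
    exact Finset.sum_le_sum fun i _ => delta_add_le_of_ne_L (blk i) (noL i)
  by_cases hLT2 : ∃ b₁ b₂, b₁ ≠ b₂ ∧ blk b₁ = KBlock.LT 1 ∧ blk b₂ = KBlock.LT 1
  · obtain ⟨b₁, b₂, hne, hb₁, hb₂⟩ := hLT2
    have := hstrict2 b₁ b₂ hne hb₁ hb₂
    left; omega
  · push Not at hLT2
    by_cases hLT1 : ∃ b₀, blk b₀ = KBlock.LT 1
    · obtain ⟨b₀, hb₀⟩ := hLT1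
      have h1 := hstrict b₀ hb₀
      have hothers : ∀ i, i ≠ b₀ → blk i ≠ KBlock.LT 1 := fun i hi h => hLT2 b₀ i hi.symm hb₀ h
      have hsum1 : ∑ i, (blk i).delta + ∑ i, (blk i).cols ≤ ∑ i, (blk i).rows + 1 := by
        have key : ∀ i, (blk i).delta + (blk i).cols ≤ (blk i).rows + if i = b₀ then 1 else 0 := by
          intro i
          by_cases hi : i = b₀
          · subst hi; rw [if_pos rfl, hb₀]; simp [rows, cols, delta]
          · rw [if_neg hi, add_zero]; exact delta_add_le_of_ne_LT_one (blk i) (noL i) (hothers i hi)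
        have := Finset.sum_le_sum fun i (_ : i ∈ Finset.univ) => key i
        rw [Finset.sum_add_distrib, Finset.sum_add_distrib, Finset.sum_ite_eq' Finset.univ b₀,
          if_pos (Finset.mem_univ _)] at this
        exact this
      right; omega
    · push Not at hLT1
      have hsum1 : ∑ i, (blk i).delta + ∑ i, (blk i).cols ≤ ∑ i, (blk i).rows := by
        rw [← Finset.sum_add_distrib]
        exact Finset.sum_le_sum fun i _ => delta_add_le_of_ne_LT_one (blk i) (noL i) (hLT1 i)
      right; omega

end DeltaLaw

end Summit.MatrixMultiplication.OmegaCensus.SmallFormats
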